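import Mathlib
import HarnessLib
import Summits.Ventures.LatticeQCDFlow.Scoring.AgreementTestLocalPower

/-!
# The Gaussian model of the energy violation: Creutz forces `Var ΔH = 2⟨ΔH⟩`, and then `⟨P_acc⟩ = 2Φ(−√(⟨ΔH⟩/2)) = erfc(½√⟨ΔH⟩)`

HONEST FRAMING: exact (Metropolis-corrected) sampling algorithms for lattice gauge theory;
figures of merit are autocorrelation/cost numbers at stated couplings and volumes; no
continuum-physics claim.

Venture `LatticeQCDFlow` (cell pub-lqcd), topic `Exactness`, FANOUT row 14 (eng-flowhmc: the
«acceptance vs step size» column of the FT-HMC test battery is usually FITTED with the Gaussian-model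
law `⟨P_acc⟩ = erfc(½√⟨ΔH⟩)`; the tree's `AcceptanceFromMeanEnergyViolation` (row 2) and
`ACCEPTANCE-LAW.md` (row 14) list that law as NOT CLAIMED because it is a statement about a MODEL of
`ΔH`).  This file states exactly what the model says, as identities about Gaussian laws — NEW WORK of
the cell over Mathlib (`gaussianReal`, `mgf_id_gaussianReal`, `gaussianPDFReal`) and row 8's
`Scoring/AgreementTestLocalPower` (`N(0,1)(−∞,0] = ½`, reused by name); nothing is cited as a fact.  Printed counterparts, named only (not used): Gupta–Irbäck–Karsch–Petersson 1990,
Kennedy–Pendleton 1991.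

* §1 **Creutz pins the variance**: for `ΔH ~ N(m, v)`, `⟨e^{−ΔH}⟩ = e^{−m + v/2}`
  (`integral_exp_neg_gaussianReal`), so the exact identity `⟨e^{−ΔH}⟩ = 1` of every
  volume-preserving reversible proposal holds in the model **iff `v = 2m`**
  (`integral_exp_neg_gaussianReal_eq_one_iff`).
* §2 **the tilt**: `e^{−x}·φ_{m,v}(x) = e^{−m+v/2}·φ_{m−v,v}(x)` (`exp_neg_mul_gaussianPDFReal`), hence
  `∫_{x>0} e^{−x} dN(m,v) = e^{−m+v/2}·N(m−v,v)(0,∞)`; and the model's mean acceptance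
  **`⟨min(1,e^{−ΔH})⟩ = N(m,v)(−∞,0] + e^{−m+v/2}·N(m−v,v)(0,∞)`** (`integral_min_one_exp_neg_gaussianReal`).
* §3 **with Creutz's constraint `v = 2m`**: `⟨min(1,e^{−ΔH})⟩ = 2·N(m,2m)(−∞,0]`
  (`integral_min_one_exp_neg_gaussianReal_creutz`) `= 2·N(0,1)(−∞,−√(m/2)]`
  (`…_creutz_std`, `m > 0`) — i.e. `erfc(½√m)`: in the model the mean acceptance is a function of
  `⟨ΔH⟩ = m` alone.
* §4 **a closed-form floor in the model**: `N(0,1)(−x,0] ≤ x/√(2π)`, hence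
  **`⟨min(1,e^{−ΔH})⟩ ≥ 1 − √(m/π)`** (`integral_min_one_exp_neg_gaussianReal_creutz_ge`) — sharper by
  the factor `√π` than the MODEL-FREE floor `1 − √m` of `AcceptanceFromMeanEnergyViolation`.

* §5 **the model's error bar for the `⟨e^{−ΔH}⟩ = 1` test**: `⟨e^{tX}⟩ = e^{tm+t²v/2}` and, with `v = 2m`,
  **`⟨(e^{−ΔH} − 1)²⟩ = e^{2m} − 1`** (`integral_sq_exp_neg_sub_one_gaussianReal_creutz`) — the 2σ
  half-width of the row's test over `n` independent trajectories is `2√((e^{2m}−1)/n) ≈ 2√(2m/n)`.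

NOT CLAIMED: that `ΔH` IS Gaussian for any engine kernel (it is not, exactly; the model is the
large-volume heuristic); any number; anything about autocorrelations.
-/

noncomputable section
namespace Summit.Ventures.LatticeQCDFlow.Exactness

open MeasureTheory ProbabilityTheory Set Filter Real
open scoped ENNReal NNReal

namespace GaussianDeltaH

variable (m : ℝ) (v : ℝ≥0)

/-! ## §1 Creutz's identity in the Gaussian model pins the variance to twice the mean -/

/-- `⟨e^{−X}⟩ = e^{−m + v/2}` for `X ~ N(m, v)` (the moment generating function at `t = −1`). -/
theorem integral_exp_neg_gaussianReal :
    ∫ x, Real.exp (-x) ∂gaussianReal m v = Real.exp (-m + v / 2) := by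
  have h := congrFun (mgf_id_gaussianReal (μ := m) (v := v)) (-1)
  simp only [mgf, id_eq] at h
  have hfun : (fun x : ℝ => Real.exp (-x)) = fun x => Real.exp (-1 * x) := funext fun x => by ring_nf
  rw [hfun, h]
  congr 1; ring

/-- **Creutz ⇔ `v = 2m`**: in the Gaussian model the exact identity `⟨e^{−ΔH}⟩ = 1` holds iff the
variance is twice the mean. -/
theorem integral_exp_neg_gaussianReal_eq_one_iff :
    ∫ x, Real.exp (-x) ∂gaussianReal m v = 1 ↔ (v : ℝ) = 2 * m := by
  rw [integral_exp_neg_gaussianReal, Real.exp_eq_one_iff]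
  constructor <;> intro h <;> linarith

/-! ## §2 The exponential tilt of a Gaussian and the model's mean acceptance -/

/-- **The tilt**: `e^{−x}·φ_{m,v}(x) = e^{−m+v/2}·φ_{m−v,v}(x)` (complete the square). -/
theorem exp_neg_mul_gaussianPDFReal (x : ℝ) :
    Real.exp (-x) * gaussianPDFReal m v x = Real.exp (-m + v / 2) * gaussianPDFReal (m - v) v x := by
  rcases eq_or_ne v 0 with hv | hv
  · simp [hv, gaussianPDFReal_zero_var]
  have hv' : (v : ℝ) ≠ 0 := by exact_mod_cast hv
  rw [gaussianPDFReal_def, gaussianPDFReal_def, mul_left_comm, ← Real.exp_add, mul_left_comm, ← Real.exp_add]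
  congr 2
  field_simp
  ring

/-- `min(1, e^{−x})` against the Gaussian density, pointwise: `1·φ` on `x ≤ 0`, the tilted density on `x > 0`. -/
theorem gaussianPDFReal_mul_min_one_exp_neg (x : ℝ) :
    gaussianPDFReal m v x * min 1 (Real.exp (-x)) =
      (Iic (0 : ℝ)).indicator (gaussianPDFReal m v) x +
        (Ioi (0 : ℝ)).indicator (fun y => Real.exp (-m + v / 2) * gaussianPDFReal (m - v) v y) x := by
  by_cases hx : x ≤ 0
  · have hx' : x ∉ Ioi (0 : ℝ) := fun h => not_lt.2 hx h
    rw [indicator_of_mem (show x ∈ Iic (0 : ℝ) from hx), indicator_of_notMem hx', add_zero,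
      min_eq_left (by rw [← Real.exp_zero]; exact Real.exp_le_exp.2 (by linarith)), mul_one]
  · have hx : 0 < x := not_le.1 hx
    have hx' : x ∉ Iic (0 : ℝ) := fun h => not_le.2 hx h
    rw [indicator_of_notMem hx', indicator_of_mem (show x ∈ Ioi (0 : ℝ) from hx), zero_add,
      min_eq_right (by rw [← Real.exp_zero]; exact Real.exp_le_exp.2 (by linarith)), mul_comm,
      exp_neg_mul_gaussianPDFReal]

/-- **THE MODEL'S MEAN ACCEPTANCE**: for `ΔH ~ N(m, v)` (`v ≠ 0`),
`⟨min(1, e^{−ΔH})⟩ = N(m,v)(−∞,0] + e^{−m+v/2}·N(m−v,v)(0,∞)`. -/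
theorem integral_min_one_exp_neg_gaussianReal (hv : v ≠ 0) :
    ∫ x, min 1 (Real.exp (-x)) ∂gaussianReal m v =
      (gaussianReal m v).real (Iic 0) + Real.exp (-m + v / 2) * (gaussianReal (m - v) v).real (Ioi 0) := by
  rw [integral_gaussianReal_eq_integral_smul hv]
  simp_rw [smul_eq_mul, gaussianPDFReal_mul_min_one_exp_neg]
  have hi1 : Integrable ((Iic (0 : ℝ)).indicator (gaussianPDFReal m v)) volume :=
    (integrable_gaussianPDFReal m v).indicator measurableSet_Iic
  have hi2 : Integrable ((Ioi (0 : ℝ)).indicator fun y => Real.exp (-m + v / 2) * gaussianPDFReal (m - v) v y) volume :=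
    ((integrable_gaussianPDFReal (m - v) v).const_mul _).indicator measurableSet_Ioi
  rw [integral_add hi1 hi2, integral_indicator measurableSet_Iic, integral_indicator measurableSet_Ioi,
    integral_const_mul, measureReal_def, measureReal_def, gaussianReal_apply_eq_integral _ hv,
    gaussianReal_apply_eq_integral _ hv,
    ENNReal.toReal_ofReal (setIntegral_nonneg measurableSet_Iic fun x _ => gaussianPDFReal_nonneg _ _ _),
    ENNReal.toReal_ofReal (setIntegral_nonneg measurableSet_Ioi fun x _ => gaussianPDFReal_nonneg _ _ _)]

/-! ## §3 Under Creutz's constraint `v = 2m` -/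

/-- `N(−m, v)(0, ∞) = N(m, v)(−∞, 0)` (reflection). -/
theorem gaussianReal_neg_real_Ioi :
    (gaussianReal (-m) v).real (Ioi 0) = (gaussianReal m v).real (Iio 0) := by
  have hpre : (fun x : ℝ => -x) ⁻¹' Ioi 0 = Iio 0 := by
    ext x
    simp only [mem_preimage, mem_Ioi, mem_Iio, Left.neg_pos_iff]
  rw [← gaussianReal_map_neg, measureReal_def, measureReal_def,
    Measure.map_apply measurable_neg measurableSet_Ioi, hpre]

/-- **WITH CREUTZ'S CONSTRAINT** `v = 2m` (`m ≠ 0`): `⟨min(1, e^{−ΔH})⟩ = 2·N(m, 2m)(−∞, 0]` — the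
model acceptance is a function of `⟨ΔH⟩ = m` alone. -/
theorem integral_min_one_exp_neg_gaussianReal_creutz (hv : (v : ℝ) = 2 * m) (hm : m ≠ 0) :
    ∫ x, min 1 (Real.exp (-x)) ∂gaussianReal m v = 2 * (gaussianReal m v).real (Iic 0) := by
  have hv0 : v ≠ 0 := by
    intro h; rw [h, NNReal.coe_zero] at hv
    exact hm (by linarith)
  rw [integral_min_one_exp_neg_gaussianReal m v hv0, hv, show -m + 2 * m / 2 = 0 by ring, Real.exp_zero, one_mul,
    show m - 2 * m = -m by ring, gaussianReal_neg_real_Ioi]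
  -- no atom at 0
  haveI : NullSingletonClass (gaussianReal m v) := nullSingletonClass_gaussianReal hv0
  have hdisj : Disjoint (Iio (0 : ℝ)) {0} := disjoint_singleton_right.2 (by simp)
  rw [measureReal_def, measureReal_def, ← Iio_union_right, measure_union hdisj (measurableSet_singleton 0),
    measure_singleton, add_zero]
  ring

/-- **Standardisation**: `N(m, v)(−∞, 0] = N(0, 1)(−∞, −m/√v]` (`v ≠ 0`). -/
theorem gaussianReal_real_Iic_zero_eq_std (hv : v ≠ 0) :
    (gaussianReal m v).real (Iic 0) = (gaussianReal 0 1).real (Iic (-m / Real.sqrt v)) := by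
  have hvpos : (0 : ℝ) < v := by exact_mod_cast pos_iff_ne_zero.2 hv
  have hsv : 0 < Real.sqrt v := Real.sqrt_pos.2 hvpos
  have hvar : NNReal.mk (Real.sqrt v ^ 2) (sq_nonneg _) * 1 = v := by
    rw [← NNReal.coe_inj]
    simp [Real.sq_sqrt hvpos.le]
  have h1 : (gaussianReal 0 1).map (Real.sqrt v * ·) = gaussianReal 0 v := by
    rw [gaussianReal_map_const_mul, mul_zero, hvar]
  have h2 : (gaussianReal 0 v).map (· + m) = gaussianReal m v := by
    rw [gaussianReal_map_add_const, zero_add]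
  have hpre : (fun z : ℝ => Real.sqrt v * z) ⁻¹' ((fun x : ℝ => x + m) ⁻¹' Iic 0) = Iic (-m / Real.sqrt v) := by
    ext z
    simp only [mem_preimage, mem_Iic]
    rw [le_div_iff₀ hsv]
    constructor <;> intro h <;> linarith [mul_comm z (Real.sqrt v)]
  rw [← h2, ← h1, measureReal_def, measureReal_def, Measure.map_apply (measurable_add_const m) measurableSet_Iic,
    Measure.map_apply (measurable_const_mul _) ((measurable_add_const m) measurableSet_Iic), hpre]

/-- **THE `erfc` LAW OF THE GAUSSIAN MODEL**: with Creutz's constraint `v = 2m`, `m > 0`,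
`⟨min(1, e^{−ΔH})⟩ = 2·N(0,1)(−∞, −√(m/2)]` (`= erfc(½√m)` in the usual notation) — a function of
the mean energy violation `m = ⟨ΔH⟩` alone. -/
theorem integral_min_one_exp_neg_gaussianReal_creutz_std (hv : (v : ℝ) = 2 * m) (hm : 0 < m) :
    ∫ x, min 1 (Real.exp (-x)) ∂gaussianReal m v = 2 * (gaussianReal 0 1).real (Iic (-Real.sqrt (m / 2))) := by
  have hv0 : v ≠ 0 := by
    intro h; rw [h, NNReal.coe_zero] at hv; linarith
  rw [integral_min_one_exp_neg_gaussianReal_creutz m v hv hm.ne', gaussianReal_real_Iic_zero_eq_std m v hv0, hv]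
  congr 3
  -- `m/√(2m) = √(m/2)`
  rw [neg_div, neg_inj, Real.sqrt_mul' 2 hm.le, Real.sqrt_div' m zero_le_two]
  rw [mul_comm, ← div_div, Real.div_sqrt]

/-! ## §4 A closed-form floor: in the model `⟨P_acc⟩ ≥ 1 − √(⟨ΔH⟩/π)` -/

/-- `N(0,1)(−x, 0] ≤ x/√(2π)` for `x ≥ 0` (the density is at most `1/√(2π)`). -/
theorem gaussianReal_std_real_Ioc_le {x : ℝ} (hx : 0 ≤ x) :
    (gaussianReal 0 1).real (Ioc (-x) 0) ≤ x / Real.sqrt (2 * π) := by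
  rw [measureReal_def, gaussianReal_apply_eq_integral _ one_ne_zero,
    ENNReal.toReal_ofReal (setIntegral_nonneg measurableSet_Ioc fun y _ => gaussianPDFReal_nonneg _ _ _)]
  have hbd : ∀ y ∈ Ioc (-x) 0, gaussianPDFReal 0 1 y ≤ (Real.sqrt (2 * π))⁻¹ := by
    intro y _
    rw [gaussianPDFReal_def]
    simp only [NNReal.coe_one, mul_one, sub_zero]
    have h1 : Real.exp (-y ^ 2 / 2) ≤ 1 := by
      rw [← Real.exp_zero]; exact Real.exp_le_exp.2 (by nlinarith [sq_nonneg y])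
    calc (Real.sqrt (2 * π))⁻¹ * Real.exp (-y ^ 2 / 2) ≤ (Real.sqrt (2 * π))⁻¹ * 1 :=
          mul_le_mul_of_nonneg_left h1 (by positivity)
      _ = (Real.sqrt (2 * π))⁻¹ := mul_one _
  calc ∫ y in Ioc (-x) 0, gaussianPDFReal 0 1 y
      ≤ ∫ _ in Ioc (-x) 0, (Real.sqrt (2 * π))⁻¹ :=
        setIntegral_mono_on (integrable_gaussianPDFReal 0 1).integrableOn (integrableOn_const (by simp))
          measurableSet_Ioc hbd
    _ = x / Real.sqrt (2 * π) := by
        rw [setIntegral_const, smul_eq_mul, Real.volume_real_Ioc, sub_neg_eq_add, zero_add, max_eq_left hx]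
        ring

/-- **THE MODEL'S CLOSED-FORM FLOOR**: with Creutz's constraint, `⟨min(1, e^{−ΔH})⟩ ≥ 1 − √(m/π)`
(`2Φ(−√(m/2)) ≥ 1 − 2√(m/2)/√(2π)`); compare the model-free `1 − √m` of
`AcceptanceFromMeanEnergyViolation.one_sub_acceptance_le_sqrt_mean`. -/
theorem integral_min_one_exp_neg_gaussianReal_creutz_ge (hv : (v : ℝ) = 2 * m) (hm : 0 < m) :
    1 - Real.sqrt (m / π) ≤ ∫ x, min 1 (Real.exp (-x)) ∂gaussianReal m v := by
  rw [integral_min_one_exp_neg_gaussianReal_creutz_std m v hv hm]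
  have hx : 0 ≤ Real.sqrt (m / 2) := Real.sqrt_nonneg _
  have hsum : (gaussianReal (0 : ℝ) 1).real (Iic (-Real.sqrt (m / 2))) +
      (gaussianReal (0 : ℝ) 1).real (Ioc (-Real.sqrt (m / 2)) 0) = (gaussianReal (0 : ℝ) 1).real (Iic 0) := by
    rw [← measureReal_union (Iic_disjoint_Ioc le_rfl) measurableSet_Ioc, Iic_union_Ioc_eq_Iic (neg_nonpos.2 hx)]
  rw [Scoring.CardConsistency.gaussianReal_real_Iic_zero] at hsum
  have hle := gaussianReal_std_real_Ioc_le hx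
  -- `2·√(m/2)/√(2π) = √(m/π)`
  have hid : 2 * (Real.sqrt (m / 2) / Real.sqrt (2 * π)) = Real.sqrt (m / π) := by
    rw [Real.sqrt_mul' 2 Real.pi_pos.le, Real.sqrt_div' m zero_le_two, Real.sqrt_div' m Real.pi_pos.le, div_div,
      ← mul_assoc, Real.mul_self_sqrt zero_le_two]
    ring
  linarith

/-! ## §5 The model's error bar for the `⟨e^{−ΔH}⟩ = 1` test: `Var e^{−ΔH} = e^{2m} − 1` -/

/-- `⟨e^{tX}⟩ = e^{tm + t²v/2}` (the moment generating function, restated pointwise). -/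
theorem integral_exp_mul_gaussianReal (t : ℝ) :
    ∫ x, Real.exp (t * x) ∂gaussianReal m v = Real.exp (t * m + v * t ^ 2 / 2) := by
  have h := congrFun (mgf_id_gaussianReal (μ := m) (v := v)) t
  simp only [mgf, id_eq] at h
  rw [h]; congr 1; ring

/-- **IN THE MODEL WITH CREUTZ'S CONSTRAINT, `Var e^{−ΔH} = ⟨(e^{−ΔH} − 1)²⟩ = e^{2m} − 1`** (`≈ 2m` for small
`m`): the half-width of the row's «`⟨e^{−ΔH}⟩ = 1` within 2σ over `n` trajectories» test is `2√((e^{2m}−1)/n)`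
for independent draws (model statement; the model-free identity `Var = ⟨e^{ΔH}⟩ − 1` is `CreutzEstimatorVariance`). -/
theorem integral_sq_exp_neg_sub_one_gaussianReal_creutz (hv : (v : ℝ) = 2 * m) :
    ∫ x, (Real.exp (-x) - 1) ^ 2 ∂gaussianReal m v = Real.exp (2 * m) - 1 := by
  have h2 : ∫ x, Real.exp (-2 * x) ∂gaussianReal m v = Real.exp (2 * m) := by
    rw [integral_exp_mul_gaussianReal m v (-2), hv]; congr 1; ring
  have h1 : ∫ x, Real.exp (-1 * x) ∂gaussianReal m v = 1 := by
    rw [integral_exp_mul_gaussianReal m v (-1), hv, Real.exp_eq_one_iff]; ring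
  have hi2 : Integrable (fun x => Real.exp (-2 * x)) (gaussianReal m v) := integrable_exp_mul_gaussianReal (-2)
  have hi1 : Integrable (fun x => Real.exp (-1 * x)) (gaussianReal m v) := integrable_exp_mul_gaussianReal (-1)
  have hexp : ∀ x : ℝ, (Real.exp (-x) - 1) ^ 2 = Real.exp (-2 * x) - 2 * Real.exp (-1 * x) + 1 := by
    intro x
    have h : Real.exp (-2 * x) = Real.exp (-x) ^ 2 := by rw [← Real.exp_nat_mul]; congr 1; push_cast; ring
    rw [h, show (-1 : ℝ) * x = -x by ring]; ring
  simp_rw [hexp]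
  have hB : Integrable (fun x => 2 * Real.exp (-1 * x)) (gaussianReal m v) := hi1.const_mul 2
  have hsub : Integrable (fun x => Real.exp (-2 * x) - 2 * Real.exp (-1 * x)) (gaussianReal m v) := hi2.sub hB
  rw [integral_add hsub (integrable_const _), integral_sub hi2 hB, integral_const_mul, integral_const,
    smul_eq_mul, probReal_univ, h2, h1]
  ring

end GaussianDeltaH

end Summit.Ventures.LatticeQCDFlow.Exactness
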